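import Literature.IUT.LogVolume.HolomorphicHull
import Literature.IUT.LogVolume.ProductVolume
import Literature.IUT.LogVolume.LocalFieldVolume
import Literature.IUT.LogThetaLattice.HolomorphicHull
import HarnessLib

/-!
# The concrete model of [IUTchIII] Remark 3.9.5 (i)(ii): the typed hull of `LogThetaLattice` IS
# the constructed hull of `LogVolume`, and its well-definedness statement is discharged

The cell's layer-L6 statement file `Literature/IUT/LogThetaLattice/HolomorphicHull.lean` (typer
abc-iut-L6-t4) types [IUTchIII] Rmk. 3.9.5 over ABSTRACT data — fields `k_i` with subrings `O_i` and
topologies: `IsHullSet O H` ("`λ·O_{(−)}`, all `λ_i ≠ 0`"), `holomorphicHull O U :=` the intersection of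
all hull sets containing `U` if `U` is relatively compact, else everything; the printed "One verifies
immediately that the holomorphic hull is well-defined" as the NAMED statement
`holomorphicHull_isHullSet O FiniteLogVol U`; and the hull map with (P1)–(P3) as the structure
`IsHullMap Preg Hul φ`, whose key hypothesis is that intersections of hull sets are hull sets.

This file is the MODEL: for a finite family `K_j` of nonarchimedean local fields in the norm
presentation (`NontriviallyNormedField`, `IsUltrametricDist`, `ProperSpace`) with `O_j = Valued.integer
(K j) = {‖x‖ ≤ 1}`, where `Literature.IUT.LogVolume.HolomorphicHull` CONSTRUCTED the hull explicitly
(polydisc of attained radii), we PROVE: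

* `lt_isHullSet_iff` — the two notions of hull set coincide;
* `sInter_hullSets_eq_holomorphicHull` — for bounded `U`, `⋂ {λ·O ⊇ U} =` the constructed hull (all
  `U`, degenerate or not), whence `lt_holomorphicHull_eq` — L6's `holomorphicHull` EQUALS the
  constructed `holomorphicHull` for every `U`;
* `lt_holomorphicHull_isHullSet` — the named well-definedness statement HOLDS with `FiniteLogVol :=
  IsNondegenerate` (each coordinate nonzero somewhere on `U`), and `isNondegenerate_of_haar_pos` — a set
  of positive volume in `⊕ K_j` is nondegenerate (the printed "contains a relatively compact subset whose
  log-volume is finite");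
* `isHullMap_holomorphicHull` — the constructed hull IS a hull map in L6's sense on the direct
  product regions (hypotheses `maps`, (P1), (P2), (P3) and the intersection property all PROVED),
  using `holomorphicHull_pi_eq_hullSet`: the hull of a direct product region `∏ A_j` is the hull set
  with radii `max_{a ∈ A_j} ‖a‖`.
[cite: Mochizuki2012, IUTchIII Rmk. 3.9.5 (i)(ii) pp. 126–128]
Deliberately NOT here: log-volumes of hulls and `Φ(P)`, `Ξ(P)` (L6's `PhiApprox`/`XiApprox` instantiate
with the packet log-volume; see `PacketVolume.lean`), any judgement on [IUTchIII] Cor. 3.12.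
-/

noncomputable section

open MeasureTheory MeasureTheory.Measure Set Metric TopologicalSpace Bornology
open scoped ENNReal NNReal Pointwise NormedField
open Literature.NumberTheory.GaloisRepresentations.Ultrametric

namespace Literature.IUT.LogVolume

variable {J : Type*} [Fintype J] (K : J → Type*) [∀ j, NontriviallyNormedField (K j)]
  [∀ j, IsUltrametricDist (K j)] [∀ j, ProperSpace (K j)]

/-! ### Hull sets: the two notions coincide -/

omit [Fintype J] [∀ j, ProperSpace (K j)] in
/-- `λ·O_k = closedBall 0 ‖λ‖` for `λ ≠ 0` (`O_k = {‖x‖ ≤ 1}`). [cite: Mochizuki2012, IUTchIII Rmk. 3.9.5 (i) p. 127] -/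
theorem image_mul_integer_eq_closedBall (j : J) {c : K j} (hc : c ≠ 0) :
    (fun x => c * x) '' ((Valued.integer (K j) : Subring (K j)) : Set (K j)) =
      closedBall (0 : K j) ‖c‖ := by
  rw [coe_integer_eq_closedBall, show (fun x : K j => c * x) = (fun x => c • x) from rfl, Set.image_smul,
    smul_closedBall' hc, smul_zero, mul_one]

omit [Fintype J] [∀ j, ProperSpace (K j)] in
/-- **L6's hull sets are the constructed hull sets**: `LogThetaLattice.IsHullSet (O_j) H ↔ IsHullSet K H`.
[cite: Mochizuki2012, IUTchIII Rmk. 3.9.5 (i) p. 127] -/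
theorem lt_isHullSet_iff (H : Set (Π j, K j)) :
    LogThetaLattice.IsHullSet (fun j => (Valued.integer (K j) : Subring (K j))) H ↔ IsHullSet K H := by
  constructor
  · rintro ⟨c, hc, rfl⟩
    refine ⟨c, hc, ?_⟩
    unfold hullSet polydisc
    congr 1
    funext j
    exact image_mul_integer_eq_closedBall K j (hc j)
  · rintro ⟨c, hc, rfl⟩
    refine ⟨c, hc, ?_⟩
    unfold hullSet polydisc
    congr 1
    funext j
    exact (image_mul_integer_eq_closedBall K j (hc j)).symm

/-! ### The intersection of all hull sets containing a bounded set is the constructed hull -/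

/-- Coordinatewise attainment: if some `u ∈ U` has `u_j ≠ 0` (`U` bounded) then `hullRadius U j` is the
norm of a coordinate of an element of `U`. [cite: Mochizuki2012, IUTchIII Rmk. 3.9.5 (i) p. 127] -/
theorem exists_norm_apply_eq_hullRadius_of_exists {U : Set (Π j, K j)} (hU : IsBounded U) (j : J)
    (hj : ∃ u ∈ U, u j ≠ 0) :
    ∃ u ∈ U, ‖u j‖ = hullRadius K U j ∧ 0 < ‖u j‖ := by
  obtain ⟨u₀, hu₀, hu₀j⟩ := hj
  have hcl : IsCompact (closure U) := hU.isCompact_closure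
  have hcont : ContinuousOn (fun u : Π j, K j => ‖u j‖) (closure U) :=
    ((continuous_apply j).norm).continuousOn
  obtain ⟨c, hc, hcmax⟩ := hcl.exists_isMaxOn ⟨u₀, subset_closure hu₀⟩ hcont
  have hcpos : 0 < ‖c j‖ := lt_of_lt_of_le (norm_pos_iff.mpr hu₀j) (hcmax (subset_closure hu₀))
  obtain ⟨t, ht, hdist⟩ := Metric.mem_closure_iff.mp hc ‖c j‖ hcpos
  have htj : ‖t j - c j‖ < ‖c j‖ := by
    calc ‖t j - c j‖ = ‖(t - c) j‖ := by simp
      _ ≤ ‖t - c‖ := norm_le_pi_norm _ j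
      _ = dist t c := (dist_eq_norm t c).symm
      _ < ‖c j‖ := by rw [dist_comm]; exact hdist
  have hteq : ‖t j‖ = ‖c j‖ := by
    have := IsUltrametricDist.norm_add_eq_max_of_norm_ne_norm htj.ne
    rw [sub_add_cancel] at this
    rw [this, max_eq_right htj.le]
  refine ⟨t, ht, le_antisymm (norm_apply_le_hullRadius K hU ht j) ?_, hteq ▸ hcpos⟩
  refine hullRadius_le K ⟨t, ht⟩ fun u hu => ?_
  rw [hteq]
  exact hcmax (subset_closure hu)

/-- **The intersection of all hull sets containing a bounded `U` is the constructed hull** (the polydisc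
of radii `sup_{u∈U} ‖u_j‖`), for EVERY bounded `U` — nondegenerate coordinates by attainment of the
radius, degenerate ones because `⋂_{λ≠0} λ·O_k = {0}`. [cite: Mochizuki2012, IUTchIII Rmk. 3.9.5 (i)(ii) p. 127] -/
theorem sInter_hullSets_eq_holomorphicHull {U : Set (Π j, K j)} (hU : IsBounded U) :
    ⋂₀ {H | IsHullSet K H ∧ U ⊆ H} = holomorphicHull K U := by
  rw [holomorphicHull_of_isBounded K hU]
  apply le_antisymm
  · -- `⋂ ⊆ polydisc`: a point outside the polydisc is outside some hull set containing `U`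
    intro x hx
    rw [mem_polydisc]
    intro j
    by_contra hxj
    rw [not_le] at hxj
    obtain ⟨R, hR⟩ := isBounded_iff_forall_norm_le.mp hU
    -- the `j`-th component of the separating `λ`
    have hcj : ∃ cj : K j, cj ≠ 0 ∧ ‖cj‖ < ‖x j‖ ∧ ∀ u ∈ U, ‖u j‖ ≤ ‖cj‖ := by
      by_cases hj : ∃ u ∈ U, u j ≠ 0
      · obtain ⟨u, hu, hnorm, hpos⟩ := exists_norm_apply_eq_hullRadius_of_exists K hU j hj
        exact ⟨u j, norm_pos_iff.mp hpos, hnorm ▸ hxj, fun v hv => hnorm ▸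
          norm_apply_le_hullRadius K hU hv j⟩
      · push Not at hj
        have hx0 : 0 < ‖x j‖ := lt_of_le_of_lt (hullRadius_nonneg K U j) hxj
        obtain ⟨cj, hcj0, hcjx⟩ := NormedField.exists_norm_lt (K j) hx0
        exact ⟨cj, norm_pos_iff.mp hcj0, hcjx, fun u hu => by rw [hj u hu, norm_zero]; positivity⟩
    obtain ⟨cj, hcj0, hcjx, hcjU⟩ := hcj
    -- the other components: anything of norm `> R`
    have hci : ∀ i : J, ∃ ci : K i, ci ≠ 0 ∧ ∀ u ∈ U, ‖u i‖ ≤ ‖ci‖ := fun i => by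
      obtain ⟨ci, hci⟩ := NormedField.exists_lt_norm (K i) (max R 0)
      refine ⟨ci, norm_pos_iff.mp (lt_of_le_of_lt (le_max_right _ _) hci), fun u hu => ?_⟩
      exact ((norm_le_pi_norm u i).trans (hR u hu)).trans ((le_max_left _ _).trans hci.le)
    classical
    choose ci hci0 hciU using hci
    let c : Π i, K i := Function.update ci j cj
    have hc0 : ∀ i, c i ≠ 0 := fun i => by
      by_cases hij : i = j
      · subst hij; simp [c, hcj0]
      · simp [c, Function.update_of_ne hij, hci0 i]
    have hUc : U ⊆ hullSet K c := fun u hu => (mem_polydisc K).mpr fun i => by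
      by_cases hij : i = j
      · subst hij; simpa [c] using hcjU u hu
      · simpa [c, Function.update_of_ne hij] using hciU i u hu
    have hxc : x ∈ hullSet K c := hx _ ⟨⟨c, hc0, rfl⟩, hUc⟩
    have := (mem_polydisc K).mp hxc j
    simp only [c, Function.update_self] at this
    exact absurd this (not_le.mpr hcjx)
  · -- `polydisc ⊆ ⋂`: every hull set containing `U` contains the polydisc of radii
    refine subset_sInter fun H hH => ?_
    obtain ⟨⟨c, hc, rfl⟩, hUH⟩ := hH
    exact polydisc_mono K (hullRadius_le_of_subset_polydisc K (fun j => norm_nonneg (c j)) hUH)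

/-- **L6's typed hull IS the constructed hull**, for every subset `U` of `⊕_j K_j`.
[cite: Mochizuki2012, IUTchIII Rmk. 3.9.5 (i) p. 127] -/
theorem lt_holomorphicHull_eq (U : Set (Π j, K j)) :
    LogThetaLattice.holomorphicHull (fun j => (Valued.integer (K j) : Subring (K j))) U =
      holomorphicHull K U := by
  unfold LogThetaLattice.holomorphicHull
  by_cases hU : IsBounded U
  · rw [if_pos ((isBounded_iff_isCompact_closure K U).mp hU), ← sInter_hullSets_eq_holomorphicHull K hU]
    congr 1
    ext H
    rw [mem_setOf_eq, mem_setOf_eq, lt_isHullSet_iff]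
  · rw [if_neg (fun h => hU ((isBounded_iff_isCompact_closure K U).mpr h)),
      holomorphicHull_of_not_isBounded K hU]

/-- **Discharge of L6's named well-definedness statement** ("One verifies immediately that the
holomorphic hull is well-defined [under the conditions stated]"): with `FiniteLogVol := IsNondegenerate`,
the typed `holomorphicHull_isHullSet` HOLDS for every `U`. [cite: Mochizuki2012, IUTchIII Rmk. 3.9.5 (i) p. 127] -/
theorem lt_holomorphicHull_isHullSet (U : Set (Π j, K j)) :
    LogThetaLattice.holomorphicHull_isHullSet (fun j => (Valued.integer (K j) : Subring (K j)))
      (IsNondegenerate K) U := by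
  intro hcpt hnd
  rw [lt_holomorphicHull_eq, lt_isHullSet_iff]
  exact isHullSet_holomorphicHull K ((isBounded_iff_isCompact_closure K U).mpr hcpt) hnd

/-! ### Positive volume implies nondegenerate -/

variable [∀ j, MeasurableSpace (K j)] [∀ j, BorelSpace (K j)]

omit [Fintype J] in
/-- A set of positive volume in a local field contains a nonzero element (`μ_k` has no atoms:
`μ_k({0}) ≤ μ_k(m_k^n) = q^{−n}` for all `n`). [cite: MochizukiAbsTopIII2015, Prop. 5.7 (i)(a) p. 137] -/
theorem exists_ne_zero_of_localVolume_pos (j : J) {A : Set (K j)} (hA : 0 < localVolume (K j) A) :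
    ∃ a ∈ A, a ≠ 0 := by
  by_contra h
  push Not at h
  have hsub : A ⊆ {0} := fun a ha => h a ha
  obtain ⟨ϖ, hϖ⟩ := exists_isUniformizer (F := K j)
  have hle : ∀ n : ℕ, (localVolume (K j) A).toReal ≤ ((residueCard (K j) : ℝ))⁻¹ ^ n := by
    intro n
    have h1 : A ⊆ closedBall (0 : K j) (‖(ϖ : K j)‖ ^ (n : ℤ)) := hsub.trans (by
      intro x hx; rw [mem_singleton_iff.mp hx]; exact mem_closedBall_self (by positivity))
    calc (localVolume (K j) A).toReal ≤ (localVolume (K j) (closedBall (0 : K j)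
          (‖(ϖ : K j)‖ ^ (n : ℤ)))).toReal :=
          ENNReal.toReal_mono (isCompact_closedBall _ _).measure_lt_top.ne (measure_mono h1)
      _ = ((residueCard (K j) : ℝ))⁻¹ ^ n := by
          rw [localVolume_real_closedBall_zpow (K j) hϖ n, zpow_neg, zpow_natCast, inv_pow]
  have hq : ((residueCard (K j) : ℝ))⁻¹ < 1 := inv_lt_one_of_one_lt₀ (one_lt_residueCard_real (K j))
  have htend := tendsto_pow_atTop_nhds_zero_of_lt_one (by positivity) hq
  have hpos : 0 < (localVolume (K j) A).toReal :=
    ENNReal.toReal_pos hA.ne' (measure_ne_top_of_subset hsub (by simp))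
  obtain ⟨n, hn⟩ := (htend.eventually (gt_mem_nhds hpos)).exists
  exact absurd (hle n) (not_le.mpr hn)

omit [Fintype J] in
/-- `μ_{K_j}({0}) = 0`. [cite: MochizukiAbsTopIII2015, Prop. 5.7 (i)(a) p. 137] -/
theorem localVolume_singleton_zero (j : J) : localVolume (K j) ({0} : Set (K j)) = 0 := by
  by_contra h
  obtain ⟨a, ha, ha0⟩ := exists_ne_zero_of_localVolume_pos K j (pos_iff_ne_zero.mpr h)
  exact ha0 (mem_singleton_iff.mp ha)

/-- **Positive volume ⟹ nondegenerate** (the printed condition "contains a relatively compact subset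
whose log-volume is finite" implies the condition under which the hull is constructed): a subset of
`⊕_j K_j` of positive `∏ O_{K_j}`-normalised volume has, for every `j`, an element with `j`-th coordinate
nonzero — the coordinate hyperplanes are null. [cite: Mochizuki2012, IUTchIII Rmk. 3.9.5 (i) p. 127] -/
theorem isNondegenerate_of_haar_pos {U : Set (Π j, K j)}
    (hU : 0 < (IntegralStructure.pi fun j => unitBallStructure (K j)).haar U) : IsNondegenerate K U := by
  classical
  intro j
  by_contra h
  push Not at h
  -- `U` lies in the coordinate hyperplane `x_j = 0`, a box with a null factor
  have hsub : U ⊆ Set.pi univ (Function.update (fun _ : J => (univ : Set _)) j ({0} : Set (K j)) ·) := by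
    intro u hu
    refine mem_univ_pi.mpr fun i => ?_
    by_cases hij : i = j
    · subst hij; simpa using h u hu
    · simp [Function.update_of_ne hij]
  have hnull : (IntegralStructure.pi fun j => unitBallStructure (K j)).haar
      (Set.pi univ (Function.update (fun _ : J => (univ : Set _)) j ({0} : Set (K j)) ·)) = 0 := by
    rw [IntegralStructure.pi_haar_pi, Finset.prod_eq_zero (Finset.mem_univ j)]
    simp only [Function.update_self]
    exact localVolume_singleton_zero K j
  exact hU.ne' (measure_mono_null hsub hnull)

/-! ### The constructed hull is a hull map in L6's sense -/

omit [∀ j, IsUltrametricDist (K j)] [∀ j, ProperSpace (K j)] [∀ j, MeasurableSpace (K j)]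
  [∀ j, BorelSpace (K j)] in
/-- The box of a family of bounded factors is bounded. [cite: Mochizuki2012, IUTchIII Rmk. 3.1.1 (iii) p. 95] -/
theorem isBounded_pi_of_isBounded {A : ∀ j, Set (K j)} (hA : ∀ j, IsBounded (A j)) :
    IsBounded (Set.pi univ A) := by
  choose R hR using fun j => (hA j).subset_closedBall (0 : K j)
  exact (isBounded_polydisc K R).subset (Set.pi_mono fun j _ => hR j)

/-- **The hull of a direct product region is a hull set with explicit radii**: for `P = ∏ A_j` with
`A_j` compact of positive volume there is `λ` with `λ_j ∈ A_j` of maximal norm, `λ_j ≠ 0`, and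
`φ(P) = λ·O_L`. [cite: Mochizuki2012, IUTchIII Rmk. 3.9.5 (i)(ii) p. 127] -/
theorem holomorphicHull_pi_eq_hullSet {A : ∀ j, Set (K j)}
    (hA : IntegralStructure.IsDirectProductRegion (fun j => unitBallStructure (K j)) A) :
    ∃ c : Π j, K j, (∀ j, c j ∈ A j ∧ c j ≠ 0 ∧ ∀ a ∈ A j, ‖a‖ ≤ ‖c j‖) ∧
      holomorphicHull K (Set.pi univ A) = hullSet K c := by
  classical
  have hne : ∀ j, (A j).Nonempty := fun j => nonempty_of_measure_ne_zero (hA.pos j).ne'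
  choose b hb using hne
  have hbd : IsBounded (Set.pi univ A) :=
    isBounded_pi_of_isBounded K fun j => (hA.isCompact j).isBounded
  -- embed a coordinate value into the box
  have hemb : ∀ j, ∀ a ∈ A j, Function.update b j a ∈ Set.pi univ A := fun j a ha i _ => by
    by_cases hij : i = j
    · subst hij; simpa using ha
    · rw [Function.update_of_ne hij]; exact hb i
  have hj : ∀ j, ∃ u ∈ Set.pi univ A, u j ≠ 0 := fun j => by
    obtain ⟨a, ha, ha0⟩ := exists_ne_zero_of_localVolume_pos K j (hA.pos j)
    exact ⟨Function.update b j a, hemb j a ha, by simpa using ha0⟩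
  choose u hu hnorm hpos using fun j => exists_norm_apply_eq_hullRadius_of_exists K hbd j (hj j)
  refine ⟨fun j => u j j, fun j => ⟨(mem_univ_pi.mp (hu j)) j, norm_pos_iff.mp (hpos j),
    fun a ha => ?_⟩, ?_⟩
  · rw [hnorm j]
    simpa using norm_apply_le_hullRadius K hbd (hemb j a ha) j
  · rw [holomorphicHull_of_isBounded K hbd]
    unfold hullSet
    congr 1
    funext j
    exact (hnorm j).symm

/-- The direct product regions of `⊕_j K_j` as a set of subsets (L6's `IsDirectProductRegion` at the
volumes `μ_{K_j}`). [cite: Mochizuki2012, IUTchIII Rmk. 3.1.1 (iii) p. 95] -/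
def directProductRegions : Set (Set (Π j, K j)) :=
  {S | ∃ A : ∀ j, Set (K j), S = Set.pi univ A ∧
    IntegralStructure.IsDirectProductRegion (fun j => unitBallStructure (K j)) A}

/-- The hull sets of `⊕_j K_j` as a set of subsets (`Hul`). [cite: Mochizuki2012, IUTchIII Rmk. 3.9.5 (ii) p. 127] -/
def hullSets : Set (Set (Π j, K j)) := {H | IsHullSet K H}

omit [Fintype J] in
/-- `Hul ⊆ Preg`: hull sets are direct product regions. [cite: Mochizuki2012, IUTchIII Rmk. 3.9.5 (ii) p. 127] -/
theorem hullSets_subset_directProductRegions : hullSets K ⊆ directProductRegions K := by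
  rintro H ⟨c, hc, rfl⟩
  refine ⟨fun j => closedBall (0 : K j) ‖c j‖, rfl, ⟨fun j => isCompact_closedBall _ _, fun j => ?_⟩⟩
  exact (IsUltrametricDist.isOpen_closedBall _ (norm_pos_iff.mpr (hc j)).ne').measure_pos _
    ⟨0, by simp⟩

/-- **The constructed hull is a hull map in the sense of L6's `IsHullMap`** on the direct product
regions: it takes values in the hull sets, and satisfies (P1), (P2), (P3) — all PROVED.
[cite: Mochizuki2012, IUTchIII Rmk. 3.9.5 (ii) p. 127] -/
theorem isHullMap_holomorphicHull :
    LogThetaLattice.IsHullMap (directProductRegions K) (hullSets K) (holomorphicHull K) where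
  maps P hP := by
    obtain ⟨A, rfl, hA⟩ := hP
    obtain ⟨c, hc, heq⟩ := holomorphicHull_pi_eq_hullSet K hA
    exact heq ▸ ⟨c, fun j => (hc j).2.1, rfl⟩
  P1 H hH := hH.holomorphicHull_eq
  P2 P _ := subset_holomorphicHull K P
  P3 P₁ _ P₂ _ h := holomorphicHull_mono K h

/-- The intersection hypothesis of L6's `hullMap_eq_sInter`/`hullMap_unique` HOLDS in the model: for a
direct product region `P`, `⋂ {H ∈ Hul | P ⊆ H}` is a hull set (namely `φ(P)`).
[cite: Mochizuki2012, IUTchIII Rmk. 3.9.5 (ii) p. 127] -/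
theorem sInter_hullSets_mem {P : Set (Π j, K j)} (hP : P ∈ directProductRegions K) :
    ⋂₀ {H | H ∈ hullSets K ∧ P ⊆ H} ∈ hullSets K := by
  obtain ⟨A, rfl, hA⟩ := hP
  have hbd : IsBounded (Set.pi univ A) :=
    isBounded_pi_of_isBounded K fun j => (hA.isCompact j).isBounded
  change ⋂₀ {H | IsHullSet K H ∧ Set.pi univ A ⊆ H} ∈ hullSets K
  rw [sInter_hullSets_eq_holomorphicHull K hbd]
  exact (isHullMap_holomorphicHull K).maps _ ⟨A, rfl, hA⟩

/-- Consequently (L6's `hullMap_unique`): ANY hull map on the direct product regions of `⊕_j K_j`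
agrees with the constructed hull there — the printed "characterized uniquely by (P1), (P2), (P3)".
[cite: Mochizuki2012, IUTchIII Rmk. 3.9.5 (ii) p. 127] -/
theorem hullMap_eq_holomorphicHull {φ : Set (Π j, K j) → Set (Π j, K j)}
    (hφ : LogThetaLattice.IsHullMap (directProductRegions K) (hullSets K) φ) {P : Set (Π j, K j)}
    (hP : P ∈ directProductRegions K) : φ P = holomorphicHull K P :=
  LogThetaLattice.hullMap_unique hφ (isHullMap_holomorphicHull K)
    (hullSets_subset_directProductRegions K) (fun _ hQ => sInter_hullSets_mem K hQ) hP

end Literature.IUT.LogVolume
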